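import Summits.PneNP.PneNP.Theorems.ReslinSizeFromWidthPCDegreeGOPProved
import Literature.Combinatorics.Expanders.BoundedConcentrator
import HarnessLib

/-!
# PneNP / ReslinSizeFromWidth — an IN-TREE bounded-degree vertex-expander family for the GOP rail (Galesi–Lauria Thm 2 shape)

Helper file for the INPUT side of crux `ResLinSizeFromWidth` (stmt-PneNP-18932).
`ReslinSizeFromWidthPCDegreeGOPProved.lean` made the PC-rail corollaries for graph ordering
principles `GOP(G)` unconditional in the EXPANDER `G` — but, as its docstring records, "explicit
families of bounded-degree vertex expanders (GL10 Thm 2 quotes a `(n/2, 1/18)`-vertex expander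
family; none is constructed in the tree)" were missing, so no infinite family of graphs was
exhibited.  This file supplies one, for EVERY number of vertices `n`, by the counting method
already in the tree:

* `exists_boundedDegree_vertexExpander` — for every `n` there is a simple graph `G` on `Fin n`
  with all degrees `≤ 12` which is an `(⌊n/72⌋, 1)`-vertex expander in the sense of Galesi–Lauria
  (`IsVertexExpander`: every `U` with `|U| ≤ n/72` has `≥ |U|` vertices outside `U` adjacent to
  `U`).  Construction: the Hall permutation expander of `BoundedConcentrator.lean`
  (`exists_hallPermExpander`, Bürgisser–Clausen–Shokrollahi Lemma 13.32 by counting) on TWO copies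
  of each vertex with three slots each (`α = Fin n × Fin 2`, `δ = Fin 3`, owner `q ↦ q.1.1`,
  `t = ⌊n/36⌋`): Hall's condition for the doubled set `U × Fin 2` says `2|U| ≤ |N(U)|`, so at
  least `|U|` of the out-neighbours lie outside `U`; symmetrising gives a simple graph of degree
  `≤ 6 + 6`.
* `exists_GOP_pcDegree_hard` — **Galesi–Lauria's Theorem 2, in-tree shape**: for every `n ≥ 72`
  and every field `K` there is a graph `G` on `Fin n` of maximum degree `≤ 12` such that `GOP(G)`
  (a 12-CNF on `n²` variables) has no PC/K refutation of degree `≤ d` for any `d ≤ ⌊n/72⌋/4`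
  (GL10: "an infinite family of simple graphs of constant degree such that … any PC refutation of
  GOP(G) requires degree at least |V(G)|/108", there for `n = 81^t` via zig-zag expanders; here for
  all `n`, constant `1/288` up to rounding, via counting).
* `exists_GOP_resLin_hard` — the rail consequences for that family (`n ≥ 3744`, `13 ≤ d ≤ ⌊n/72⌋/4`):
  every Res(⊕) refutation (semantic weakening) of `GOP(G)` has a line of rank `≥ d`, tree-like ones
  have `≥ 2^(d-13)` lines, `2 + (d-1)d ≤ 2|π| + 156`, and clause space `≥ d - 11`.

Honest framing: the expander is obtained by the probabilistic/counting method (existence, not an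
explicit construction); constants are crude.  The mathematics of the degree bound is
Galesi–Lauria's (proved in the tree, gen 12).  Not here: the polynomial-size RESOLUTION upper bound
for `GOP(G)` (Stålmarck; GL10 Lemma 1), i.e. the optimality half of GL10 Thm 2.

References: N. Galesi, M. Lauria, ACM ToCL 12(1) (2010), Def. 1, Prop. 1, Thm 1, Thm 2
[GalesiLauria2010]; P. Bürgisser, M. Clausen, M. A. Shokrollahi, *Algebraic Complexity Theory*
(1997), Lemma (13.32) [BurgisserClausenShokrollahi1997]; S. Hoory, N. Linial, A. Wigderson,
Bull. AMS 43 (2006), §1.2.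
-/

noncomputable section

namespace Summit.PneNP.PneNP.Theorems

-- `Summit.PneNP.PneNP` repeats a path component by design (summit = sub-problem); silence the linter.
set_option linter.dupNamespace false

namespace ResLinPC

open Finset Literature.Computability.Complexity Literature.Computability.MetaComplexity
open Literature.Combinatorics.Expanders
open Summit.PneNP.PneNP.Theorems.PolyCalc

/-! ### The symmetrised out-neighbourhood graph -/

/-- The simple graph on `Fin n` generated by out-neighbourhood lists `nbr`: `x ~ y` iff `x ≠ y`
and `y ∈ nbr x` or `x ∈ nbr y`. [this file] -/
def symmGraph {n : ℕ} (nbr : Fin n → Finset (Fin n)) : SimpleGraph (Fin n) :=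
  SimpleGraph.fromRel fun x y => y ∈ nbr x

/-- Adjacency in `symmGraph nbr` is decidable. [this file] -/
instance symmGraph.decidableRel {n : ℕ} (nbr : Fin n → Finset (Fin n)) :
    DecidableRel (symmGraph nbr).Adj := by
  unfold symmGraph
  infer_instance

/-- Adjacency in `symmGraph nbr`. [this file] -/
theorem symmGraph_adj {n : ℕ} (nbr : Fin n → Finset (Fin n)) (x y : Fin n) :
    (symmGraph nbr).Adj x y ↔ x ≠ y ∧ (y ∈ nbr x ∨ x ∈ nbr y) := by
  rw [symmGraph, SimpleGraph.fromRel_adj]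

/-- Degrees in `symmGraph nbr`: at most `|nbr v| + #{y : v ∈ nbr y}`. [this file] -/
theorem degree_symmGraph_le {n : ℕ} (nbr : Fin n → Finset (Fin n)) (v : Fin n) :
    (symmGraph nbr).degree v ≤ (nbr v).card + (univ.filter fun y => v ∈ nbr y).card := by
  have hsub : (symmGraph nbr).neighborFinset v ⊆ nbr v ∪ (univ.filter fun y => v ∈ nbr y) := by
    intro w hw
    rw [SimpleGraph.mem_neighborFinset, symmGraph_adj] at hw
    rcases hw.2 with h | h
    · exact mem_union_left _ h
    · exact mem_union_right _ (mem_filter.2 ⟨mem_univ _, h⟩)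
  rw [← SimpleGraph.card_neighborFinset_eq_degree]
  exact (card_le_card hsub).trans (card_union_le _ _)

/-- Vertex expansion of `symmGraph nbr` from a lower bound on out-neighbourhoods: if
`2|U| ≤ |⋃_{x ∈ U} nbr x|` then `|Γ(U)| ≥ |U|`. [this file] -/
theorem card_le_outerNeighbors_symmGraph {n : ℕ} (nbr : Fin n → Finset (Fin n)) (U : Finset (Fin n))
    (h : 2 * U.card ≤ (U.biUnion nbr).card) : U.card ≤ (outerNeighbors (symmGraph nbr) U).card := by
  have hsub : U.biUnion nbr ⊆ outerNeighbors (symmGraph nbr) U ∪ U := by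
    intro y hy
    obtain ⟨x, hx, hyx⟩ := mem_biUnion.1 hy
    by_cases hyU : y ∈ U
    · exact mem_union_right _ hyU
    · refine mem_union_left _ ((mem_outerNeighbors (symmGraph nbr)).2 ⟨hyU, x, hx, ?_⟩)
      rw [symmGraph_adj]
      exact ⟨fun hxy => hyU (hxy ▸ hx), Or.inl hyx⟩
  have hle := (card_le_card hsub).trans (card_union_le _ _)
  omega

/-! ### A bounded-degree vertex expander on every `Fin n` -/

/-- **Bounded-degree vertex expanders exist on every vertex set** (counting): for every `n`
there is a simple graph on `Fin n` with all degrees `≤ 12` that is an `(⌊n/72⌋, 1)`-vertex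
expander (Galesi–Lauria Def. 1).  From the Hall permutation expander on two copies of each
vertex with three slots each. [Bürgisser–Clausen–Shokrollahi 1997, Lemma (13.32) (counting);
Galesi–Lauria 2010, Def. 1 / Prop. 1 (shape)] -/
theorem exists_boundedDegree_vertexExpander (n : ℕ) :
    ∃ G : SimpleGraph (Fin n), ∃ _ : DecidableRel G.Adj,
      (∀ v, G.degree v ≤ 12) ∧ IsVertexExpander G (n / 72) 1 := by
  -- the Hall permutation expander: α = two copies of each vertex, δ = three slots, owner = vertex
  have hown : ∀ y : Fin n,
      (univ.filter fun q : (Fin n × Fin 2) × Fin 3 => q.1.1 = y).card ≤ 6 := by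
    intro y
    have : (univ.filter fun q : (Fin n × Fin 2) × Fin 3 => q.1.1 = y) =
        ((({y} : Finset (Fin n)) ×ˢ (univ : Finset (Fin 2))) ×ˢ (univ : Finset (Fin 3))) := by
      ext q
      simp only [mem_filter, mem_univ, true_and, mem_product, mem_singleton, and_true]
    rw [this, card_product, card_product, card_singleton, card_univ, card_univ, Fintype.card_fin,
      Fintype.card_fin]
  obtain ⟨σ, hσ⟩ := exists_hallPermExpander (α := Fin n × Fin 2) (β := Fin n) (δ := Fin 3)
    (fun q => q.1.1) (n / 36) 1 6 (by simp) hown (by simpa using Nat.div_le_self n 36)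
    (by simp only [Fintype.card_prod, Fintype.card_fin]; omega)
    (by
      simp only [Fintype.card_prod, Fintype.card_fin]
      have h36 := Nat.div_mul_le_self n 36
      have : 18 * n * (n / 36) ^ 1 * 6 ^ (1 + 2) = 108 * n * (n / 36 * 36) := by ring
      rw [this]
      calc 108 * n * (n / 36 * 36) ≤ 108 * n * n := Nat.mul_le_mul_left _ h36
        _ = (n * 2) ^ (1 + 1) * (1 + 2) ^ (1 + 2) := by ring)
  -- out-neighbourhoods: the owners of the images of the six slots of the two copies of `x`
  let nbr : Fin n → Finset (Fin n) := fun x =>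
    (((({x} : Finset (Fin n)) ×ˢ (univ : Finset (Fin 2))) ×ˢ (univ : Finset (Fin 3))).image
      fun q => (σ q).1.1)
  refine ⟨symmGraph nbr, inferInstance, fun v => ?_, fun U hU => ?_⟩
  · -- degree ≤ |nbr v| + |{y : v ∈ nbr y}| ≤ 6 + 6
    have h1 : (nbr v).card ≤ 6 := by
      refine card_image_le.trans ?_
      rw [card_product, card_product, card_singleton, card_univ, card_univ, Fintype.card_fin,
        Fintype.card_fin]
    have h2 : (univ.filter fun y => v ∈ nbr y).card ≤ 6 := by
      have hsub' : (univ.filter fun y => v ∈ nbr y) ⊆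
          (univ.filter fun q : (Fin n × Fin 2) × Fin 3 => (σ q).1.1 = v).image fun q => q.1.1 := by
        intro y hy
        rw [mem_filter] at hy
        obtain ⟨q, hq, hqv⟩ := mem_image.1 hy.2
        refine mem_image.2 ⟨q, mem_filter.2 ⟨mem_univ _, hqv⟩, ?_⟩
        simp only [mem_product, mem_singleton, mem_univ, and_true] at hq
        exact hq
      have hcard : (univ.filter fun q : (Fin n × Fin 2) × Fin 3 => (σ q).1.1 = v).card =
          (univ.filter fun q : (Fin n × Fin 2) × Fin 3 => q.1.1 = v).card :=
        Finset.card_equiv σ fun q => by simp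
      exact (card_le_card hsub').trans (card_image_le.trans (hcard.le.trans (hown v)))
    have h := degree_symmGraph_le nbr v
    omega
  · -- vertex expansion: Hall's condition for the doubled set `U × Fin 2`
    have hS : (U ×ˢ (univ : Finset (Fin 2))).card ≤ n / 36 := by
      rw [card_product, card_univ, Fintype.card_fin]
      omega
    have hHall := hσ (U ×ˢ univ) hS
    rw [card_product, card_univ, Fintype.card_fin] at hHall
    have himg : (((U ×ˢ (univ : Finset (Fin 2))) ×ˢ (univ : Finset (Fin 3))).image
        fun q => (σ q).1.1) ⊆ U.biUnion nbr := by
      intro y hy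
      obtain ⟨q, hq, rfl⟩ := mem_image.1 hy
      have hx : q.1.1 ∈ U := by
        simp only [mem_product, mem_univ, and_true] at hq
        exact hq
      refine mem_biUnion.2 ⟨q.1.1, hx, mem_image.2 ⟨q, ?_, rfl⟩⟩
      simp only [mem_product, mem_singleton, mem_univ, and_true]
    have h2U : 2 * U.card ≤ (U.biUnion nbr).card := by
      have := card_le_card himg
      omega
    rw [one_mul]
    exact_mod_cast card_le_outerNeighbors_symmGraph nbr U h2U

/-! ### Galesi–Lauria's Theorem 2, in-tree shape -/

/-- **GL10 Theorem 2 (in-tree shape): an infinite family of constant-degree graphs whose graph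
ordering principles need linear PC degree over every field.**  For every `n ≥ 72` and every field
`K` there is a simple graph `G` on `Fin n` with all degrees `≤ 12` such that `GOP(G)` has no PC/K
refutation of degree `≤ d` whenever `d ≤ ⌊n/72⌋/4`. [Galesi–Lauria 2010, Thm 2 (shape; there
`|V(G)|/108` for `n = 81^t` via Prop. 1), Thm 1 (proved in the tree)] -/
theorem exists_GOP_pcDegree_hard (K : Type*) [Field K] (n : ℕ) (hn : 72 ≤ n) :
    ∃ G : SimpleGraph (Fin n), ∃ _ : DecidableRel G.Adj, (∀ v, G.degree v ≤ 12) ∧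
      ∀ d : ℕ, (d : ℝ) ≤ ((n / 72 : ℕ) : ℝ) / 4 →
        ¬ PC.RefutableInDegree (PC.ofCNF K (GOP.glGOP G)) d := by
  obtain ⟨G, inst, hdeg, hexp⟩ := exists_boundedDegree_vertexExpander n
  refine ⟨G, inst, hdeg, fun d hd => ?_⟩
  have hr : 1 ≤ n / 72 := (Nat.le_div_iff_mul_le (by norm_num)).2 (by omega)
  exact GOP.not_refutableInDegree_glGOP (K := K) hexp one_pos hr (by rw [one_mul]; exact hd)

/-- **The GOP rail on the in-tree expander family**: for every `n ≥ 3744` there is a graph `G` on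
`Fin n` with all degrees `≤ 12` such that for every `d` with `13 ≤ d ≤ ⌊n/72⌋/4`: every Res(⊕)
refutation (semantic weakening) of `GOP(G)` has a line of rank `≥ d`, every tree-like one has
`≥ 2^(d-13)` lines, every one satisfies `2 + (d-1)d ≤ 2|π| + 156`, and every configuration-style
one has clause space `≥ d + 1 - 12`. [Galesi–Lauria 2010, Thms 1–2; Gryaznov–Ovcharov–Riazanov
2024, Cor. 2; Efremenko–Garlík–Itsykson 2024, §1.1.1; the tree's rail] -/
theorem exists_GOP_resLin_hard (n : ℕ) (hn : 3744 ≤ n) :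
    ∃ G : SimpleGraph (Fin n), ∃ _ : DecidableRel G.Adj, (∀ v, G.degree v ≤ 12) ∧
      ∀ d : ℕ, 13 ≤ d → (d : ℝ) ≤ ((n / 72 : ℕ) : ℝ) / 4 →
        (∀ π : List ResLinLine, IsResLinRefutation (GOP.glGOP G) π →
          d ≤ resLinWidth π ∧
          ((∀ i : ℕ, (π.map fun l => l.premises.count i).sum ≤ 1) → 2 ^ (d - 13) ≤ π.length) ∧
          2 + (d - 1) * d ≤ 2 * π.length + 156) ∧
        ∀ ϖ : List (Finset LinClause), IsResLinSpaceRefutation (GOP.glGOP G) ϖ →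
          d + 1 - 12 ≤ resLinClauseSpace ϖ := by
  obtain ⟨G, inst, hdeg, hexp⟩ := exists_boundedDegree_vertexExpander n
  refine ⟨G, inst, hdeg, fun d h13 hd => ?_⟩
  have hr : 1 ≤ n / 72 := (Nat.le_div_iff_mul_le (by norm_num)).2 (by omega)
  have hd' : (d : ℝ) ≤ 1 * (n / 72 : ℕ) / 4 := by rw [one_mul]; exact hd
  have h3 : 3 ≤ d := by omega
  have hdeg' : ∀ u, G.degree u ≤ d := fun u => (hdeg u).trans (by omega)
  refine ⟨fun π hπ => ⟨resLinWidth_glGOP' G hr one_pos hexp h3 hdeg' hd' hπ, fun htree => ?_, ?_⟩,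
    fun ϖ hϖ => clauseSpace_glGOP' G hr one_pos hexp (by norm_num) hdeg (by omega) hd' hϖ⟩
  · have h := treeLike_length_glGOP' G hr one_pos hexp (by norm_num) hdeg (by omega) hd' hπ htree
    rw [Nat.sub_sub] at h
    exact h
  · have h := quadratic_length_glGOP' G hr one_pos hexp (by norm_num) hdeg (by omega) hd' hπ
    simpa using h

end ResLinPC

end Summit.PneNP.PneNP.Theorems
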